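import Mathlib.Topology.Algebra.ClopenNhdofOne
import Mathlib.Topology.Algebra.OpenSubgroup
import Mathlib.Topology.Algebra.ContinuousMonoidHom
import Mathlib.GroupTheory.RegularWreathProduct
import Mathlib.Data.ZMod.Basic
import HarnessLib

/-!
# Uniqueness of continuous homomorphisms to finite groups forces topological generation
# (profinite groups; [EtTh] §1 p. 12 "`Δ_X` is a profinite free group on 2 generators")

Mochizuki, *The étale theta function and its Frobenioid-theoretic manifestations*, Publ. RIMS **45**
(2009) [EtTh], §1 PRIMS PDF p. 12: "Since `Δ_X` is a profinite free group on 2 generators …"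
[cite: MochizukiEtTh2009, §1 p.12]; the wreath-product trick is Ribes–Zalesskii, *Profinite Groups*
(2010), §3.3 (free profinite groups: a basis converging to 1 topologically generates).
Layer L2 of the abc-iut cell, seat abc-iut-L5-t14 (item N8 context: the structure of the theta group
`Δ^Θ_X = Δ_X/[Δ_X,[Δ_X,Δ_X]]`).  THEOREMS ONLY, Mathlib-only imports.

The cell's guard predicate `IsFreeProfiniteOnTwo` (`EtaleTheta/Setting.lean`) — and the L3 predicate
`IsFreeProfiniteOn` — phrase freeness as a UNIVERSAL PROPERTY with UNIQUENESS against finite discrete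
groups: "every pair of elements of a finite discrete group is the image of `(a, b)` under a unique
continuous homomorphism".  This file extracts the standard consequence that the UNIQUENESS clause
alone already forces TOPOLOGICAL GENERATION:

* `topologicalClosure_closure_eq_top_of_hom_ext` — in a profinite (compact, totally disconnected)
  group `P`, if any two continuous homomorphisms to a finite discrete group that agree on a subset `S`
  are equal, then the closed subgroup generated by `S` is all of `P`.

PROOF (wreath-product trick): if `M = ⟨S⟩⁻ ≠ P`, pick `g ∉ M` and an open normal subgroup `N` with
`g ∉ M·N` (profiniteness); in the finite group `Q = P/N` let `S' = image of M`; in the regular wreath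
product `W = (ℤ/2) ≀ Q` conjugation by the indicator function `v` of `S'` fixes `(1, q)` exactly when
`q ∈ S'`, so `P → Q → W` and its `v`-conjugate agree on `S` but differ at `g`.
HONEST FRAMING: classical profinite group theory; nothing of [EtTh] is asserted.
-/

namespace Literature.Topology.Algebra

universe u

open _root_.Topology

/-- In the regular wreath product `D ≀ᵣ Q`, conjugating `inl q = (1, q)` by an element `v = (φ, 1)` of
the base gives `(x ↦ φ x · (φ (q⁻¹ x))⁻¹, q)`; in particular it is again `inl q` iff `φ` is invariant
under `x ↦ q⁻¹ x`.  Here: the `left` component formula. [cite: MochizukiEtTh2009, §1 p.12] -/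
theorem RegularWreathProduct.conj_inl_left {D Q : Type*} [Group D] [Group Q] (φ : Q → D) (q x : Q) :
    ((⟨φ, 1⟩ : D ≀ᵣ Q) * RegularWreathProduct.inl q * (⟨φ, 1⟩ : D ≀ᵣ Q)⁻¹).left x =
      φ x * (φ (q⁻¹ * x))⁻¹ := by
  simp [RegularWreathProduct.mul_def, RegularWreathProduct.inv_left, RegularWreathProduct.inv_right,
    RegularWreathProduct.inl]

/-- … and the `right` component is `q`. [cite: MochizukiEtTh2009, §1 p.12] -/
theorem RegularWreathProduct.conj_inl_right {D Q : Type*} [Group D] [Group Q] (φ : Q → D) (q : Q) :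
    ((⟨φ, 1⟩ : D ≀ᵣ Q) * RegularWreathProduct.inl q * (⟨φ, 1⟩ : D ≀ᵣ Q)⁻¹).right = q := by
  simp [RegularWreathProduct.mul_def, RegularWreathProduct.inv_right, RegularWreathProduct.inl]

/-- **Uniqueness of continuous homomorphisms to finite groups forces topological generation.**
Let `P` be a profinite group (compact, totally disconnected topological group) and `S ⊆ P`.  If any
two continuous homomorphisms from `P` to a finite discrete group which agree on `S` are equal, then
the closure of the subgroup generated by `S` is `P`.  (Applied to the uniqueness clause of
"`Δ_X` is a profinite free group on 2 generators", [EtTh] p. 12: the two generators topologically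
generate `Δ_X`.) [cite: MochizukiEtTh2009, §1 p.12] -/
theorem topologicalClosure_closure_eq_top_of_hom_ext {P : Type u} [Group P] [TopologicalSpace P]
    [IsTopologicalGroup P] [CompactSpace P] [TotallyDisconnectedSpace P] (S : Set P)
    (hext : ∀ (W : Type u) [Group W] [Finite W] [TopologicalSpace W] [DiscreteTopology W]
      (f₁ f₂ : P →ₜ* W), (∀ s ∈ S, f₁ s = f₂ s) → f₁ = f₂) :
    (Subgroup.closure S).topologicalClosure = ⊤ := by
  classical
  by_contra hM
  obtain ⟨g, -, hg⟩ := SetLike.exists_of_lt (lt_top_iff_ne_top.mpr hM)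
  have hMc : IsClosed (((Subgroup.closure S).topologicalClosure : Subgroup P) : Set P) :=
    Subgroup.isClosed_topologicalClosure _
  -- an open normal subgroup `N` with `g ∉ M · N`
  have hUopen : IsOpen {x : P | g * x ∈ (((Subgroup.closure S).topologicalClosure : Subgroup P) :
      Set P)ᶜ} :=
    (hMc.isOpen_compl).preimage (by fun_prop)
  have h1U : (1 : P) ∈ {x : P | g * x ∈ (((Subgroup.closure S).topologicalClosure : Subgroup P) :
      Set P)ᶜ} := by
    change g * 1 ∈ (((Subgroup.closure S).topologicalClosure : Subgroup P) : Set P)ᶜ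
    rw [mul_one]
    exact hg
  obtain ⟨N, hN⟩ := ProfiniteGrp.exist_openNormalSubgroup_sub_open_nhds_of_one hUopen h1U
  -- the finite discrete quotient `Q = P/N` and the image `S'` of `M`
  haveI hQd : DiscreteTopology (P ⧸ N.toSubgroup) := QuotientGroup.discreteTopology N.isOpen'
  haveI hQf : Finite (P ⧸ N.toSubgroup) :=
    Subgroup.quotient_finite_of_isOpen N.toSubgroup N.isOpen'
  let π : P →* P ⧸ N.toSubgroup := QuotientGroup.mk' N.toSubgroup
  let S' : Subgroup (P ⧸ N.toSubgroup) := (Subgroup.closure S).topologicalClosure.map π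
  -- the wreath product `W = (ℤ/2) ≀ Q` with the discrete topology, and the indicator `v` of `S'`
  letI : TopologicalSpace (Multiplicative (ZMod 2) ≀ᵣ (P ⧸ N.toSubgroup)) := ⊥
  haveI : DiscreteTopology (Multiplicative (ZMod 2) ≀ᵣ (P ⧸ N.toSubgroup)) := ⟨rfl⟩
  let φ : P ⧸ N.toSubgroup → Multiplicative (ZMod 2) :=
    fun q => if q ∈ S' then Multiplicative.ofAdd 1 else 1
  let v : Multiplicative (ZMod 2) ≀ᵣ (P ⧸ N.toSubgroup) := ⟨φ, 1⟩
  -- the two continuous homomorphisms `f₁ = inl ∘ π` and `f₂ = conj(v) ∘ f₁`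
  have hπc : Continuous π := QuotientGroup.continuous_mk
  have hc₁ : Continuous (fun q : P ⧸ N.toSubgroup =>
      (RegularWreathProduct.inl q : Multiplicative (ZMod 2) ≀ᵣ (P ⧸ N.toSubgroup))) :=
    continuous_of_discreteTopology
  have hc₂ : Continuous (fun q : P ⧸ N.toSubgroup =>
      v * (RegularWreathProduct.inl q : Multiplicative (ZMod 2) ≀ᵣ (P ⧸ N.toSubgroup)) * v⁻¹) :=
    continuous_of_discreteTopology
  let f₁ : P →ₜ* (Multiplicative (ZMod 2) ≀ᵣ (P ⧸ N.toSubgroup)) :=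
    { toMonoidHom := RegularWreathProduct.inl.comp π
      continuous_toFun := hc₁.comp hπc }
  let f₂ : P →ₜ* (Multiplicative (ZMod 2) ≀ᵣ (P ⧸ N.toSubgroup)) :=
    { toMonoidHom := (MulAut.conj v).toMonoidHom.comp (RegularWreathProduct.inl.comp π)
      continuous_toFun := hc₂.comp hπc }
  have hf₁ : ∀ p : P, f₁ p = RegularWreathProduct.inl (π p) := fun p => rfl
  have hf₂ : ∀ p : P, f₂ p = v * RegularWreathProduct.inl (π p) * v⁻¹ := fun p => rfl
  -- `f₁ p = f₂ p` iff `π p ∈ S'`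
  have hagree : ∀ p : P, π p ∈ S' → f₁ p = f₂ p := by
    intro p hp
    rw [hf₁, hf₂]
    ext x
    · rw [RegularWreathProduct.conj_inl_left, RegularWreathProduct.left_inl, Pi.one_apply]
      have hiff : x ∈ S' ↔ (π p)⁻¹ * x ∈ S' := by
        constructor
        · exact fun hx => S'.mul_mem (S'.inv_mem hp) hx
        · intro hx
          have := S'.mul_mem hp hx
          rwa [mul_inv_cancel_left] at this
      by_cases hx : x ∈ S'
      · have hx' : (π p)⁻¹ * x ∈ S' := hiff.mp hx
        simp [φ, hx, hx']
      · have hx' : (π p)⁻¹ * x ∉ S' := fun h => hx (hiff.mpr h)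
        simp [φ, hx, hx']
    · rw [RegularWreathProduct.conj_inl_right, RegularWreathProduct.right_inl]
  have hdetect : ∀ p : P, f₁ p = f₂ p → π p ∈ S' := by
    intro p hp
    have h : (f₁ p).left (π p) = (f₂ p).left (π p) := by rw [hp]
    rw [hf₁, hf₂, RegularWreathProduct.left_inl, Pi.one_apply, RegularWreathProduct.conj_inl_left,
      inv_mul_cancel] at h
    by_contra hnot
    have hφp : φ (π p) = 1 := by simp [φ, hnot]
    have hφ1 : φ 1 = Multiplicative.ofAdd 1 := by simp [φ, S'.one_mem]
    rw [hφp, hφ1, one_mul] at h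
    exact absurd h (by decide)
  -- uniqueness: `f₁ = f₂` since they agree on `S ⊆ M`
  have heq : f₁ = f₂ := hext _ f₁ f₂ fun s hs =>
    hagree s ⟨s, Subgroup.le_topologicalClosure _ (Subgroup.subset_closure hs), rfl⟩
  -- hence `π g ∈ S'`, i.e. `g ∈ M · N`: contradiction
  obtain ⟨m, hm, hmg⟩ := hdetect g (by rw [heq])
  have hn : m⁻¹ * g ∈ N.toSubgroup := by
    rw [← QuotientGroup.eq]; exact hmg
  have hn' : g⁻¹ * m ∈ (N : Set P) := by
    have := N.toSubgroup.inv_mem hn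
    rwa [mul_inv_rev, inv_inv] at this
  have := hN hn'
  simp only [Set.mem_setOf_eq, mul_inv_cancel_left, Set.mem_compl_iff, SetLike.mem_coe] at this
  exact this hm

end Literature.Topology.Algebra
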